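import Literature.NumberTheory.GaloisRepresentations.SemiLocalPrincipalUnitsOrbitFactors
import HarnessLib

/-!
# Transporting a one-place component of `∏_{w∣v} U¹_w` by `σ ∈ Gal(E/F)`: the `σw`-component of `σ · x̃_w` is `σ_w(x_w)`, and for a GLOBAL (diagonal) unit
# `x = (e)_w` it is `(σ e)_{σ w}` — the terms of the orbit-factor formula are the CONJUGATES of the global unit read at the base place
# (Cassels–Fröhlich VII §1.1; de Shalit III §1.3–1.4)

Topic `NumberTheory/GaloisRepresentations`; namespace `Literature.NumberTheory.GaloisRepresentations.SemiLocal`, continuing `SemiLocalPrincipalUnitsOrbitFactors.lean`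
(`principalUnitGroupProj`, `principalPlaceSummand`, `coordSummandEquiv` lifts) — the companion of `SemiLocalPrincipalUnitsOrbitFactorsFormula.lean`, whose
`principalUnitGroupCoinvEquivPiOrbits_mk_eq_sum` writes the class of an arbitrary `x ∈ ∏ U¹` orbit by orbit as `Σ_w χ(t_w) • [((φ t_w)⁻¹ · x̃_w)_{w(O(w))}]` with
`x̃_w` the lift of the `w`-th coordinate.  THIS file computes those terms:
* ★ `coe_proj_principalUnitGroupRepr_placeLift` — the `w₀`-component of `σ · x̃_w` (`σ w = w₀`) is `σ_w(x_w)`, the continuous extension `galAdicCompletionMap σ` applied to the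
  `w`-component of `x`;
* ★★ `coe_proj_principalUnitGroupRepr_placeLift_of_eq_coe` — if the `w`-component of `x` is a GLOBAL element `e ∈ E` (e.g. `x` the diagonal image of a global / elliptic unit),
  that component is `(σ e)_{w₀}` (for the diagonal `diag e` use `diag_apply`): **the orbit-factor class of a global unit is the `χ`-weighted sum of its CONJUGATES `(φ t_w)⁻¹ e` read at the base place** — the coset
  sums `Σ_t χ(t)·[(e^{t⁻¹})_𝔓]` of the cell's memos (BRICK-C-PADIC-g20 F26, BRICK-C-SHAPIRO-g21 F29) that the local Coleman theory evaluates.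
Theorems only; no definition, no named fact, no `sorry`, no instance.

## References
* [CasselsFrohlichANT1967] J. W. S. Cassels, A. Fröhlich (eds.), *Algebraic Number Theory* (1967), Ch. VII (Tate) §1.1 (`σ_w : L_w → L_{σw}` extends `σ`).
* [deShalit1987] E. de Shalit, *Iwasawa theory of elliptic curves with complex multiplication* (1987), III §1.3–1.4.
* [Brown1982CohomologyGroups] K. S. Brown, *Cohomology of Groups* (1982), III §5 Prop. (5.3), (5.8).
-/

noncomputable section

open scoped Classical
open NumberField IsDedekindDomain
open Literature.NumberTheory.Automorphic

namespace Literature.NumberTheory.GaloisRepresentations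

namespace SemiLocal

open Literature.Algebra.Homology Literature.Algebra.Homology.InducedModule Literature.Algebra.Homology.CoinducedModule

variable {F : Type} [Field F] [NumberField F] {E : Type} [Field E] [NumberField E] [Algebra F E]
variable {v : HeightOneSpectrum (𝓞 F)}

omit [NumberField F] in
/-- The `w`-component of the lift `x̃_w` of the `w`-th coordinate of `x` is the `w`-component of `x`. [cite: Brown1982CohomologyGroups, III §5 Prop. (5.8)] -/
theorem coe_placeLift_apply_self (w : Place F E v) (x : Additive (principalUnitGroup F E v)) :
    (((Additive.toMul (((coordSummandEquiv (fun w' : Place F E v => principalUnitGroupProj (F := F) w') bijective_pi_principalUnitGroupProj w).symm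
        (principalUnitGroupProj w x) : Additive (principalUnitGroup F E v))) : principalUnitGroup F E v) : (SemiLocal F E v)ˣ) : SemiLocal F E v) w =
      (((Additive.toMul x : principalUnitGroup F E v) : (SemiLocal F E v)ˣ) : SemiLocal F E v) w := by
  rw [← coe_coe_toMul_principalUnitGroupProj, ← coe_coe_toMul_principalUnitGroupProj w x,
    pi_coordSummandEquiv_symm_apply (fun w' : Place F E v => principalUnitGroupProj (F := F) w') bijective_pi_principalUnitGroupProj w]

/-- ★ **The `w₀`-component of `σ · x̃_w` is `σ_w(x_w)`** (`σ w = w₀`; `x̃_w` the lift of the `w`-th coordinate of `x`): transporting a one-place component by `σ` applies the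
continuous extension `σ_w : E_w → E_{σ w}`. [cite: CasselsFrohlichANT1967, Ch. VII §1.1] [cite: Brown1982CohomologyGroups, III §5 Prop. (5.3)] -/
theorem coe_proj_principalUnitGroupRepr_placeLift (σ : E ≃ₐ[F] E) {w w₀ : Place F E v} (hσ : σ • w = w₀) (x : Additive (principalUnitGroup F E v)) :
    (((Additive.toMul (principalUnitGroupProj w₀ (principalUnitGroupRepr F E v σ
        ((coordSummandEquiv (fun w' : Place F E v => principalUnitGroupProj (F := F) w') bijective_pi_principalUnitGroupProj w).symm
          (principalUnitGroupProj w x) : Additive (principalUnitGroup F E v)))) :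
        ((w₀ : HeightOneSpectrum (𝓞 E)).adicCompletionIntegers E).principalUnitGroup) : ((w₀ : HeightOneSpectrum (𝓞 E)).adicCompletion E)ˣ) :
          (w₀ : HeightOneSpectrum (𝓞 E)).adicCompletion E) =
      galAdicCompletionMap σ (show σ • (w : HeightOneSpectrum (𝓞 E)) = w₀ from congrArg Place.val hσ)
        ((((Additive.toMul x : principalUnitGroup F E v) : (SemiLocal F E v)ˣ) : SemiLocal F E v) w) := by
  rw [coe_coe_toMul_principalUnitGroupProj, Herbrand.coe_toMul_stableRepr, MulDistribMulAction.toMulAut_apply, MulDistribMulAction.toMulEquiv_apply,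
    val_smul_units, smul_apply, ← coe_placeLift_apply_self w x]
  exact galAdicCompletionMap_congr_place (inv_smul_eq_iff.mpr hσ.symm) _ _ _

/-- ★★ **For a GLOBAL component**: if the `w`-component of `x` is the image of `e ∈ E` (e.g. `x` = the diagonal image of a global unit), then the `w₀`-component of
`σ · x̃_w` is `(σ e)_{w₀}` — with `σ = (φ t_w)⁻¹`, `w₀ = w(O(w))` these are the terms of `principalUnitGroupCoinvEquivPiOrbits_mk_eq_sum`: the orbit-factor class of a
global unit is the `χ`-weighted sum of its conjugates read at the base place. [cite: CasselsFrohlichANT1967, Ch. VII §1.1] [cite: deShalit1987, III §1.3–1.4] -/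
theorem coe_proj_principalUnitGroupRepr_placeLift_of_eq_coe (σ : E ≃ₐ[F] E) {w w₀ : Place F E v} (hσ : σ • w = w₀) (x : Additive (principalUnitGroup F E v))
    {e : E} (he : (((Additive.toMul x : principalUnitGroup F E v) : (SemiLocal F E v)ˣ) : SemiLocal F E v) w = (e : (w : HeightOneSpectrum (𝓞 E)).adicCompletion E)) :
    (((Additive.toMul (principalUnitGroupProj w₀ (principalUnitGroupRepr F E v σ
        ((coordSummandEquiv (fun w' : Place F E v => principalUnitGroupProj (F := F) w') bijective_pi_principalUnitGroupProj w).symm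
          (principalUnitGroupProj w x) : Additive (principalUnitGroup F E v)))) :
        ((w₀ : HeightOneSpectrum (𝓞 E)).adicCompletionIntegers E).principalUnitGroup) : ((w₀ : HeightOneSpectrum (𝓞 E)).adicCompletion E)ˣ) :
          (w₀ : HeightOneSpectrum (𝓞 E)).adicCompletion E) =
      ((σ e : E) : (w₀ : HeightOneSpectrum (𝓞 E)).adicCompletion E) := by
  rw [coe_proj_principalUnitGroupRepr_placeLift σ hσ x, he, galAdicCompletionMap_coe_algEquiv]

end SemiLocal

end Literature.NumberTheory.GaloisRepresentations

end
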